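import Summits.BirchSwinnertonDyer.Rank1Residual.Ordinary.FormalFiltrationDivisibility
import Literature.NumberTheory.EllipticCurves.ComplexMultiplicationCoatesWilesReductionIndexProofs
import Summits.BirchSwinnertonDyer.Rank1Residual.O5.SignedLevelRaisingTransferThree
import Mathlib.NumberTheory.Padics.RingHoms
import HarnessLib

/-!
# `E₁(ℚ_p) ≅ ℤ_p` for `p` odd, and `E(ℚ_p)/p^k·E(ℚ_p) ≅ ℤ/p^k` generated by ANY point `P ∉ p·E(ℚ_p)` at
# a good non-anomalous odd `p` — the local input «`H¹_f(ℚ_p, E[p^k]) = E(ℚ_p)/p^k` is free of rank one,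
# generated by `P` when `m_p(P) = 0`» of the depth-law derivation, PROVED

HONEST FRAMING (cell `b2b-bsdres`, run/shared/lean/b2b/bsd-rank1-residual/, verbatim in every
file): the goal of the cell is to DELETE the COMBINATION-SHAPED residual classes of the
Birch–Swinnerton-Dyer formula for ALL analytic-rank `≤ 1` elliptic curves over `ℚ` — "full BSD
formula for every rank `≤ 1` curve in class `C`" assembled STRICTLY from published theorems — so
that the rank-`≤ 1` remainder becomes exactly the CONSTRUCTION-SHAPED classes, which are TYPED
(missing-input `Prop`s), NOT attempted. This is not "finishing BSD". Seat `b2b-bsdres-additive-p3`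
(typer-designate for the cell conjecture C-16, hyp R-16 (e)). THEOREMS ONLY (no definition, no named
fact): Silverman AEC IV.6.4 (b) / VII.6.3 statements about `E(ℚ_p)` read through the tree's
`WeierstrassCurve.formalFiltration` layer and the sibling `Ordinary/FormalFiltrationDivisibility.lean`
(`E⁽ᵏ⁺¹⁾ = p·E⁽ᵏ⁾`, `k ≥ 1`, `p` odd; the `n`-trick). Nothing about any particular curve is asserted,
nothing is booked, no mark / label / count / tier moves; C-16 stays a CONJECTURE (data-suggested, never
theorem).

## Why this file

The derivation of the rank-one depth law (`HOME/b2b-bsdres-additive-p3/R1-DEPTH-LAW.md` §2 (i), (iii);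
hyp `SHARPENED-CONJECTURES.md` §120 D94.3) uses at the prime `p` itself: «`E(ℚ_p) ⊗ ℤ_p ≅ ℤ_p` at a good
non-anomalous `p`; `H¹_f(ℚ_p, E[p^{k′}]) = E(ℚ_p)/p^{k′} ≅ ℤ/p^{k′}` is free of rank one; the class of the
generator `P` has exponent `k′ − min(k′, m_p(P))`, so it GENERATES when `m_p(P) = 0`» — the `m₃(P) = 0`
clause of C-16's letter (`¬ O5.PointLocallyThreeDivisibleAt W 3 P`). This file proves these local
statements (the cohomological identification `H¹_f = E(ℚ_p)/p^k` is not needed and not typed):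

* §1 (`V/ℚ_p` `p`-integral elliptic, `p` odd): **`E⁽¹⁾(ℚ_p) = E₁(ℚ_p) ≃+ ℤ_p`** (AEC IV.6.4 (b) at
  `r = 1 > v(p)/(p − 1)`): `[p] : E⁽¹⁾ → E⁽²⁾` is an additive bijection (injective: `E₁(ℚ_p)` is
  torsion-free for odd `p`, tree `eq_zero_of_isOfFinAddOrder_of_isInReductionKernel`; onto: the sibling's
  `E⁽²⁾ = p·E⁽¹⁾`) and `E⁽²⁾ ≃+ ℤ_p` is the tree's `nonempty_formalFiltration_addEquiv_padicInt`. Then,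
  for ANY `P₁ ∈ E⁽¹⁾ ∖ E⁽²⁾` (level exactly `1`; its image in `ℤ_p` is a UNIT because `E⁽²⁾ = p·E⁽¹⁾`):
  every `R ∈ E⁽¹⁾` is `c·P₁ + p^k·Q` with `c ∈ ℕ`, `Q ∈ E⁽¹⁾` (`PadicInt.appr`), and
  `c·P₁ ∈ p^k·E⁽¹⁾ ⟹ p^k ∣ c` — `E⁽¹⁾/p^k·E⁽¹⁾ ≅ ℤ/p^k` generated by `P₁`.
* §2 (the `n`-trick, `p ∤ n`, `n·E(ℚ_p) ⊆ E₁(ℚ_p)`): the same two statements for ALL of `E(ℚ_p)`: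
  every `R ∈ E(ℚ_p)` is `c·P₁ + p^k·Q` (`c ∈ ℤ`, `Q ∈ E(ℚ_p)`), and `c·P₁ = p^k·Q ⟹ p^k ∣ c` —
  **`E(ℚ_p)/p^k·E(ℚ_p) ≅ ℤ/p^k`, generated by any point of `E₁` of level exactly `1`.**
* §3 (`W/ℚ` globally minimal elliptic, `p` odd, `p ∤ Δ_min`, `p ∤ #Ẽ(𝔽_p)`, `n = #Ẽ(𝔽_p)`): for every
  `P ∈ E(ℚ_p)` with **`P ∉ p·E(ℚ_p)` (`m_p(P) = 0`)**: `#Ẽ(𝔽_p)·P` has level exactly `1`, so **`P` itself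
  generates `E(ℚ_p)/p^k·E(ℚ_p) ≅ ℤ/p^k` for every `k`** (`∀ R, ∃ c Q, R = c·P + p^k·Q` and
  `c·P = p^k·Q ⟹ p^k ∣ c`); in general, if `#Ẽ(𝔽_p)·P` has level exactly `m + 1` (`m = m_p(P)`, the
  sibling `PointDivisibilityFormalLevel`'s reading) and `m ≤ k`: **`c·P ∈ p^k·E(ℚ_p) ⟺ p^{k−m} ∣ c`** — the
  class of `P` is `p^{min(k, m_p)}` times a generator (the `m_p ≥ 1` strata of C-17); at `p = 3` good
  non-anomalous the `m = 0` case is stated on a rational point under C-16's clause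
  `¬ PointLocallyThreeDivisibleAt W 3 P`.

References: J. H. Silverman, AEC 2nd ed. (2009), IV.6.4 (b), VII.2.1, VII.2.2, VII.6.3 [SilvermanAEC2009];
hyp `SHARPENED-CONJECTURES.md` §120 C120.1 (clause `m₃(P) = 0`), D94.3; additive-p3 `R1-DEPTH-LAW.md` §2.
-/

noncomputable section

open scoped Classical

open WeierstrassCurve Literature.NumberTheory.EllipticCurves

namespace Summit.BirchSwinnertonDyer.Rank1Residual.Ordinary

/-! ### §1 `E⁽¹⁾(ℚ_p) ≃+ ℤ_p` (`p` odd) and `E⁽¹⁾/p^k·E⁽¹⁾ ≅ ℤ/p^k` generated by any point of level `1` -/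

section Local

variable {p : ℕ} [Fact p.Prime] (V : WeierstrassCurve ℚ_[p]) [hV : V.IsIntegral ℤ_[p]] [V.IsElliptic]

/-- **`E⁽¹⁾(ℚ_p) = E₁(ℚ_p) ≃+ ℤ_p` for `p` odd** (AEC IV.6.4 (b) at `r = 1 > v(p)/(p − 1)`, VII.6.3):
`[p] : E⁽¹⁾ → E⁽²⁾` is an additive bijection — injective because `E₁(ℚ_p)` is torsion-free for odd `p`
(tree `eq_zero_of_isOfFinAddOrder_of_isInReductionKernel`), onto by the sibling's `E⁽²⁾ = p·E⁽¹⁾`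
(`exists_p_nsmul_eq_of_mem_formalFiltration_succ`) — and `E⁽²⁾ ≃+ ℤ_p` is the tree's
`nonempty_formalFiltration_addEquiv_padicInt`. (`E⁽⁰⁾ = E⁽¹⁾`: tree `formalFiltration_one_eq_zero`.)
[cite: SilvermanAEC2009, IV.6.4 (b) and VII.6.3] -/
theorem nonempty_formalFiltration_one_addEquiv_padicInt (hp2 : p ≠ 2) :
    Nonempty (V.formalFiltration 1 ≃+ ℤ_[p]) := by
  have hp : p.Prime := Fact.out
  obtain ⟨e⟩ := V.nonempty_formalFiltration_addEquiv_padicInt (le_refl 2)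
  let φ : V.formalFiltration 1 →+ V.formalFiltration 2 :=
    AddMonoidHom.mk' (fun P => ⟨p • (P : V.toAffine.Point), p_nsmul_mem_formalFiltration_succ V P.2⟩)
      fun P Q => Subtype.ext (by
        change p • ((P : V.toAffine.Point) + Q) = p • (P : V.toAffine.Point) + p • (Q : V.toAffine.Point)
        exact nsmul_add _ _ _)
  have hφ : ∀ P : V.formalFiltration 1, ((φ P : V.formalFiltration 2) : V.toAffine.Point) =
      p • (P : V.toAffine.Point) := fun P => rfl
  have hinj : Function.Injective φ := by
    rw [injective_iff_map_eq_zero]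
    intro P hP
    have h0 : p • (P : V.toAffine.Point) = 0 := by
      rw [← hφ P, hP]
      rfl
    have hfin : IsOfFinAddOrder (P : V.toAffine.Point) :=
      isOfFinAddOrder_iff_nsmul_eq_zero.mpr ⟨p, hp.pos, h0⟩
    exact Subtype.ext (V.eq_zero_of_isOfFinAddOrder_of_isInReductionKernel hp2 P.2.1 hfin)
  have hsurj : Function.Surjective φ := by
    intro R
    obtain ⟨Q, hQ, hQR⟩ := exists_p_nsmul_eq_of_mem_formalFiltration_succ V hp2 le_rfl R.2
    exact ⟨⟨Q, hQ⟩, Subtype.ext (by rw [hφ]; exact hQR)⟩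
  exact ⟨(AddEquiv.ofBijective φ ⟨hinj, hsurj⟩).trans e⟩

/-- Under any additive isomorphism `e : E⁽¹⁾ ≃+ ℤ_p` (`p` odd), a point of `E⁽¹⁾ ∖ E⁽²⁾` maps to a UNIT of
`ℤ_p`: a non-unit is `p·y`, and `e⁻¹(p·y) = p·e⁻¹(y) ∈ p·E⁽¹⁾ ⊆ E⁽²⁾`. [folklore] -/
private theorem isUnit_of_not_mem_formalFiltration_two (e : V.formalFiltration 1 ≃+ ℤ_[p])
    {P₁ : V.toAffine.Point} (hP₁ : P₁ ∈ V.formalFiltration 1) (hP₁' : P₁ ∉ V.formalFiltration 2) :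
    IsUnit (e ⟨P₁, hP₁⟩) := by
  by_contra hu
  have hmem : e ⟨P₁, hP₁⟩ ∈ IsLocalRing.maximalIdeal ℤ_[p] := hu
  rw [PadicInt.maximalIdeal_eq_span_p, Ideal.mem_span_singleton'] at hmem
  obtain ⟨y, hy⟩ := hmem
  have hP : (⟨P₁, hP₁⟩ : V.formalFiltration 1) = p • e.symm y := by
    apply e.injective
    rw [map_nsmul, e.apply_symm_apply, ← hy, nsmul_eq_mul, mul_comm]
  have hP' : P₁ = p • ((e.symm y : V.formalFiltration 1) : V.toAffine.Point) :=
    congrArg Subtype.val hP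
  exact hP₁' (hP' ▸ p_nsmul_mem_formalFiltration_succ V (e.symm y).2)

/-- **`E⁽¹⁾/p^k·E⁽¹⁾ ≅ ℤ/p^k`, generated by ANY point of level exactly `1`** (`p` odd): for
`P₁ ∈ E⁽¹⁾ ∖ E⁽²⁾` and every `R ∈ E⁽¹⁾` there are `c ∈ ℕ` and `Q ∈ E⁽¹⁾` with `R = c·P₁ + p^k·Q` (write
`e(R)·e(P₁)⁻¹ = c + p^k·y` with `PadicInt.appr`). [cite: SilvermanAEC2009, IV.6.4 (b) and VII.6.3] -/
theorem exists_eq_nsmul_add_pow_smul_of_level_one (hp2 : p ≠ 2) {P₁ : V.toAffine.Point}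
    (hP₁ : P₁ ∈ V.formalFiltration 1) (hP₁' : P₁ ∉ V.formalFiltration 2) (k : ℕ)
    {R : V.toAffine.Point} (hR : R ∈ V.formalFiltration 1) :
    ∃ c : ℕ, ∃ Q ∈ V.formalFiltration 1, R = c • P₁ + p ^ k • Q := by
  obtain ⟨e⟩ := nonempty_formalFiltration_one_addEquiv_padicInt V hp2
  obtain ⟨u, hu⟩ := isUnit_of_not_mem_formalFiltration_two V e hP₁ hP₁'
  set x : ℤ_[p] := e ⟨R, hR⟩ with hx
  -- `x * u⁻¹ = c + p^k * y`
  set w : ℤ_[p] := x * ↑u⁻¹ with hw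
  have happr := PadicInt.appr_spec k w
  rw [Ideal.mem_span_singleton'] at happr
  obtain ⟨y, hy⟩ := happr
  set c : ℕ := w.appr k with hc
  have hxdecomp : x = (c : ℤ_[p]) * e ⟨P₁, hP₁⟩ + (p : ℤ_[p]) ^ k * (y * e ⟨P₁, hP₁⟩) := by
    have h1 : w = (c : ℤ_[p]) + y * (p : ℤ_[p]) ^ k := by rw [hy]; ring
    calc x = w * ↑u := by rw [hw, mul_assoc, Units.inv_mul, mul_one]
      _ = ((c : ℤ_[p]) + y * (p : ℤ_[p]) ^ k) * e ⟨P₁, hP₁⟩ := by rw [h1, hu]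
      _ = (c : ℤ_[p]) * e ⟨P₁, hP₁⟩ + (p : ℤ_[p]) ^ k * (y * e ⟨P₁, hP₁⟩) := by ring
  -- pull back along `e`
  set Q : V.formalFiltration 1 := e.symm (y * e ⟨P₁, hP₁⟩) with hQ
  have hRQ : (⟨R, hR⟩ : V.formalFiltration 1) = c • ⟨P₁, hP₁⟩ + p ^ k • Q := by
    apply e.injective
    rw [map_add, map_nsmul, map_nsmul, hQ, e.apply_symm_apply, ← hx, hxdecomp, nsmul_eq_mul,
      nsmul_eq_mul, Nat.cast_pow]
  refine ⟨c, Q, Q.2, ?_⟩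
  have := congrArg Subtype.val hRQ
  simpa only [AddSubgroup.coe_add, AddSubmonoidClass.coe_nsmul] using this

/-- **… and the class of `P₁` has order `p^k`: `c·P₁ ∈ p^k·E⁽¹⁾ ⟹ p^k ∣ c`** (`c ∈ ℤ`; apply `e`:
`c·e(P₁) ∈ p^kℤ_p` with `e(P₁)` a unit). [cite: SilvermanAEC2009, IV.6.4 (b) and VII.6.3] -/
theorem pow_dvd_of_zsmul_eq_pow_smul_of_level_one (hp2 : p ≠ 2) {P₁ : V.toAffine.Point}
    (hP₁ : P₁ ∈ V.formalFiltration 1) (hP₁' : P₁ ∉ V.formalFiltration 2) {k : ℕ} {c : ℤ}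
    {Q : V.toAffine.Point} (hQ : Q ∈ V.formalFiltration 1) (h : c • P₁ = p ^ k • Q) :
    (p ^ k : ℤ) ∣ c := by
  obtain ⟨e⟩ := nonempty_formalFiltration_one_addEquiv_padicInt V hp2
  obtain ⟨u, hu⟩ := isUnit_of_not_mem_formalFiltration_two V e hP₁ hP₁'
  have h1 : c • (⟨P₁, hP₁⟩ : V.formalFiltration 1) = p ^ k • ⟨Q, hQ⟩ :=
    Subtype.ext (by simpa only [AddSubgroupClass.coe_zsmul, AddSubmonoidClass.coe_nsmul] using h)
  have h2 : (c : ℤ_[p]) * e ⟨P₁, hP₁⟩ = (p : ℤ_[p]) ^ k * e ⟨Q, hQ⟩ := by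
    have := congrArg e h1
    rwa [map_zsmul, map_nsmul, zsmul_eq_mul, nsmul_eq_mul, Nat.cast_pow] at this
  have hmem : (c : ℤ_[p]) ∈ (Ideal.span {(p : ℤ_[p]) ^ k} : Ideal ℤ_[p]) := by
    rw [Ideal.mem_span_singleton']
    refine ⟨e ⟨Q, hQ⟩ * ↑u⁻¹, ?_⟩
    calc e ⟨Q, hQ⟩ * ↑u⁻¹ * (p : ℤ_[p]) ^ k = ((p : ℤ_[p]) ^ k * e ⟨Q, hQ⟩) * ↑u⁻¹ := by ring
      _ = (c : ℤ_[p]) * e ⟨P₁, hP₁⟩ * ↑u⁻¹ := by rw [h2]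
      _ = (c : ℤ_[p]) := by rw [← hu, mul_assoc, Units.mul_inv, mul_one]
  rw [← PadicInt.norm_le_pow_iff_mem_span_pow] at hmem
  exact PadicInt.norm_int_le_pow_iff_dvd.mp hmem

end Local

/-! ### §2 All of `E(ℚ_p)`: the `n`-trick -/

section Trick

/-- Bézout re-assembly in an abelian group: from `n • x = c • g + m • q` with `gcd(n, m) = 1`,
`x = c' • g + m • q'` for some `c' ∈ ℤ`, `q'`. [folklore] -/
private theorem exists_eq_zsmul_add_smul_of_coprime {G : Type*} [AddCommGroup G] {m n : ℕ}
    (hcop : Nat.Coprime n m) {x g q : G} {c : ℕ} (h : n • x = c • g + m • q) :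
    ∃ (c' : ℤ) (q' : G), x = c' • g + m • q' := by
  have hbez : (n : ℤ) * Nat.gcdA n m + (m : ℤ) * Nat.gcdB n m = 1 := by
    rw [← Nat.gcd_eq_gcd_ab, hcop.gcd_eq_one, Nat.cast_one]
  refine ⟨Nat.gcdA n m * c, Nat.gcdA n m • q + Nat.gcdB n m • x, ?_⟩
  symm
  calc (Nat.gcdA n m * c) • g + m • (Nat.gcdA n m • q + Nat.gcdB n m • x)
      = Nat.gcdA n m • (c • g + m • q) + ((m : ℤ) * Nat.gcdB n m) • x := by
        rw [smul_add, smul_add, mul_smul, natCast_zsmul, smul_comm (m : ℕ) (Nat.gcdA n m) q,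
          mul_smul, natCast_zsmul]
        abel
    _ = ((n : ℤ) * Nat.gcdA n m + (m : ℤ) * Nat.gcdB n m) • x := by
        rw [← h, add_smul, mul_comm (n : ℤ) (Nat.gcdA n m), mul_smul (Nat.gcdA n m) (n : ℤ) x,
          natCast_zsmul]
    _ = x := by rw [hbez, one_smul]

variable {p : ℕ} [Fact p.Prime] (V : WeierstrassCurve ℚ_[p]) [hV : V.IsIntegral ℤ_[p]] [V.IsElliptic]

/-- For `p ∤ n`, `n·P₁` has the same level as `P₁` (`‖z(nP)‖ = ‖z(P)‖`, tree
`norm_formalParameter_nsmul_of_not_dvd`): `P₁ ∈ E⁽¹⁾ ∖ E⁽²⁾ ⟹ n·P₁ ∉ E⁽²⁾`. [folklore] -/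
theorem nsmul_not_mem_formalFiltration_two {n : ℕ} (hn : ¬ p ∣ n) {P₁ : V.toAffine.Point}
    (hP₁ : P₁ ∈ V.formalFiltration 1) (hP₁' : P₁ ∉ V.formalFiltration 2) :
    n • P₁ ∉ V.formalFiltration 2 := by
  intro h
  apply hP₁'
  refine ⟨hP₁.1, ?_⟩
  rw [← V.norm_formalParameter_nsmul_of_not_dvd hn hP₁.1]
  exact h.2

/-- **`E(ℚ_p)/p^k·E(ℚ_p)` is generated by any `P₁ ∈ E⁽¹⁾ ∖ E⁽²⁾`** when `p` is odd, `p ∤ n` and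
`n·E(ℚ_p) ⊆ E₁(ℚ_p)`: every `R ∈ E(ℚ_p)` is `c·P₁ + p^k·Q` with `c ∈ ℤ` (`n·R ∈ E⁽¹⁾` is
`c₀·P₁ + p^k·Q₀` by §1; Bézout `a·n + b·p^k = 1`). [cite: SilvermanAEC2009, IV.6.4 (b) and VII.2.1] -/
theorem exists_eq_zsmul_add_pow_smul (hp2 : p ≠ 2) {n : ℕ} (hn : ¬ p ∣ n)
    (hker : ∀ Q : V.toAffine.Point, V.IsInReductionKernel (n • Q)) {P₁ : V.toAffine.Point}
    (hP₁ : P₁ ∈ V.formalFiltration 1) (hP₁' : P₁ ∉ V.formalFiltration 2) (k : ℕ)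
    (R : V.toAffine.Point) : ∃ (c : ℤ) (Q : V.toAffine.Point), R = c • P₁ + p ^ k • Q := by
  have hp : p.Prime := Fact.out
  have hnR : n • R ∈ V.formalFiltration 1 := by
    rw [V.formalFiltration_one_eq_zero]
    exact V.mem_formalFiltration_zero_iff.mpr (hker R)
  obtain ⟨c, Q, -, hcQ⟩ := exists_eq_nsmul_add_pow_smul_of_level_one V hp2 hP₁ hP₁' k hnR
  have hcop : Nat.Coprime n (p ^ k) :=
    Nat.Coprime.pow_right _ ((Nat.Prime.coprime_iff_not_dvd hp).mpr hn).symm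
  exact exists_eq_zsmul_add_smul_of_coprime hcop hcQ

/-- **… and the class of `P₁` in `E(ℚ_p)/p^k·E(ℚ_p)` has order `p^k`: `c·P₁ = p^k·Q ⟹ p^k ∣ c`**
(`Q ∈ E(ℚ_p)` arbitrary; multiply by `n`: `n·Q ∈ E₁`, `n·P₁` has level `1`, §1).
[cite: SilvermanAEC2009, IV.6.4 (b) and VII.2.1] -/
theorem pow_dvd_of_zsmul_eq_pow_smul (hp2 : p ≠ 2) {n : ℕ} (hn : ¬ p ∣ n)
    (hker : ∀ Q : V.toAffine.Point, V.IsInReductionKernel (n • Q)) {P₁ : V.toAffine.Point}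
    (hP₁ : P₁ ∈ V.formalFiltration 1) (hP₁' : P₁ ∉ V.formalFiltration 2) {k : ℕ} {c : ℤ}
    {Q : V.toAffine.Point} (h : c • P₁ = p ^ k • Q) : (p ^ k : ℤ) ∣ c := by
  have hnQ : n • Q ∈ V.formalFiltration 1 := by
    rw [V.formalFiltration_one_eq_zero]
    exact V.mem_formalFiltration_zero_iff.mpr (hker Q)
  have hnP₁ : n • P₁ ∈ V.formalFiltration 1 := AddSubgroup.nsmul_mem _ hP₁ n
  have hnP₁' : n • P₁ ∉ V.formalFiltration 2 := nsmul_not_mem_formalFiltration_two V hn hP₁ hP₁'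
  have h' : c • (n • P₁) = p ^ k • (n • Q) := by
    rw [← smul_comm n c P₁, h, nsmul_left_comm Q n (p ^ k)]
  exact pow_dvd_of_zsmul_eq_pow_smul_of_level_one V hp2 hnP₁ hnP₁' hnQ h'

end Trick

/-! ### §3 At a good non-anomalous odd `p` of a curve over `ℚ`: a point with `m_p(P) = 0` generates -/

section Global

variable (W : WeierstrassCurve ℚ) [W.IsElliptic] [W.IsGloballyMinimal] (p : ℕ) [Fact p.Prime]

/-- **`m_p(P) = 0 ⟹ P generates E(ℚ_p)/p^k·E(ℚ_p) ≅ ℤ/p^k` for every `k`**, at an odd prime `p ∤ Δ_min(E)`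
with `p ∤ #Ẽ(𝔽_p)`: if `P ∉ p·E(ℚ_p)` then `#Ẽ(𝔽_p)·P ∈ E⁽¹⁾ ∖ E⁽²⁾` (AEC VII.2.1 + the sibling's `n`-trick),
so every `R ∈ E(ℚ_p)` is `c·P + p^k·Q` and `c·P = p^k·Q ⟹ p^k ∣ c` — the derivation's «`E(ℚ_p)/p^{k′} ≅
ℤ/p^{k′}`, generated by the class of `P` when `m_p = 0`». [cite: SilvermanAEC2009, IV.6.4 (b) and VII.2.1] -/
theorem generates_mod_pow_of_not_exists_p_smul_eq (hp2 : p ≠ 2)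
    (hgood : ¬ (p : ℤ) ∣ minimalDiscriminantInt W) (hna : ¬ p ∣ W.reductionPointCount p)
    {P : (W.baseChange ℚ_[p]).toAffine.Point} (hP : ¬ ∃ Q : (W.baseChange ℚ_[p]).toAffine.Point, p • Q = P)
    (k : ℕ) :
    (∀ R : (W.baseChange ℚ_[p]).toAffine.Point,
        ∃ (c : ℤ) (Q : (W.baseChange ℚ_[p]).toAffine.Point), R = c • P + p ^ k • Q) ∧
      ∀ (c : ℤ) (Q : (W.baseChange ℚ_[p]).toAffine.Point), c • P = p ^ k • Q → (p ^ k : ℤ) ∣ c := by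
  set n := W.reductionPointCount p with hn
  have hker : ∀ Q : (W.baseChange ℚ_[p]).toAffine.Point, (W.baseChange ℚ_[p]).IsInReductionKernel (n • Q) :=
    W.isInReductionKernel_reductionPointCount_nsmul p hgood
  -- `n • P` has level exactly `1`
  have hP1 : n • P ∈ (W.baseChange ℚ_[p]).formalFiltration 1 := by
    rw [(W.baseChange ℚ_[p]).formalFiltration_one_eq_zero]
    exact (W.baseChange ℚ_[p]).mem_formalFiltration_zero_iff.mpr (hker P)
  have hP2 : n • P ∉ (W.baseChange ℚ_[p]).formalFiltration 2 := by
    intro h2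
    apply hP
    have h := (exists_pow_smul_eq_iff_nsmul_mem_formalFiltration (W.baseChange ℚ_[p]) hp2 hna hker P 1).mpr h2
    simpa only [pow_one] using h
  refine ⟨fun R => ?_, fun c Q h => ?_⟩
  · obtain ⟨c, Q, hRQ⟩ := exists_eq_zsmul_add_pow_smul (W.baseChange ℚ_[p]) hp2 hna hker hP1 hP2 k R
    refine ⟨c * n, Q, ?_⟩
    rw [hRQ, mul_smul, natCast_zsmul]
  · have h' : c • (n • P) = p ^ k • (n • Q) := by
      rw [← smul_comm n c P, h, nsmul_left_comm Q n (p ^ k)]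
    exact pow_dvd_of_zsmul_eq_pow_smul (W.baseChange ℚ_[p]) hp2 hna hker hP1 hP2 h'

/-- **In general the class of `P` in `E(ℚ_p)/p^k·E(ℚ_p) ≅ ℤ/p^k` is `p^{m}` times a generator, `m = m_p(P)`:
if `#Ẽ(𝔽_p)·P` has level exactly `m + 1` (the sibling `PointDivisibilityFormalLevel`'s reading of `m_p`)
and `m ≤ k`, then `c·P ∈ p^k·E(ℚ_p) ⟺ p^{k−m} ∣ c`** (`c ∈ ℤ`) — the derivation's «the class of `P` in
`H¹_f(ℚ_p, E[p^k]) ≅ ℤ/p^k` has divisibility exponent `min(k, m_p)`», i.e. order `p^{k − min(k, m_p)}`; the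
`m_p ≥ 1` strata of C-17 = C120.2. (`#Ẽ(𝔽_p)·P = p^m·P₂` with `P₂` of level exactly `1`, by the sibling's
`E⁽ᵐ⁺¹⁾ = p^m·E₁`; then §1–§2 for `P₂`.) [cite: SilvermanAEC2009, IV.6.4 (b) and VII.2.1] -/
theorem exists_pow_smul_eq_zsmul_iff_pow_sub_dvd (hp2 : p ≠ 2)
    (hgood : ¬ (p : ℤ) ∣ minimalDiscriminantInt W) (hna : ¬ p ∣ W.reductionPointCount p)
    {P : (W.baseChange ℚ_[p]).toAffine.Point} {m : ℕ}
    (hm1 : W.reductionPointCount p • P ∈ (W.baseChange ℚ_[p]).formalFiltration (m + 1))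
    (hm2 : W.reductionPointCount p • P ∉ (W.baseChange ℚ_[p]).formalFiltration (m + 2))
    {k : ℕ} (hmk : m ≤ k) (c : ℤ) :
    (∃ Q : (W.baseChange ℚ_[p]).toAffine.Point, p ^ k • Q = c • P) ↔ (p ^ (k - m) : ℤ) ∣ c := by
  have hker : ∀ Q : (W.baseChange ℚ_[p]).toAffine.Point,
      (W.baseChange ℚ_[p]).IsInReductionKernel (W.reductionPointCount p • Q) :=
    W.isInReductionKernel_reductionPointCount_nsmul p hgood
  -- `n • P = p^m • P₂` with `P₂` of level exactly `1`
  obtain ⟨P₂, hP₂, hP₂eq⟩ :=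
    exists_pow_smul_eq_of_mem_formalFiltration_succ (W.baseChange ℚ_[p]) hp2 m hm1
  have hP₂' : P₂ ∉ (W.baseChange ℚ_[p]).formalFiltration 2 := by
    intro h2
    apply hm2
    have h := pow_smul_mem_formalFiltration_add (W.baseChange ℚ_[p]) h2 m
    rwa [hP₂eq, add_comm] at h
  have hkey : W.reductionPointCount p • (c • P) = (c * (p ^ m : ℕ)) • P₂ := by
    rw [mul_zsmul, natCast_zsmul, hP₂eq, smul_comm (W.reductionPointCount p) c P]
  have hpk : (p : ℤ) ^ (k - m) * (p : ℤ) ^ m = (p : ℤ) ^ k := by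
    rw [← pow_add, Nat.sub_add_cancel hmk]
  constructor
  · rintro ⟨Q, hQ⟩
    have h1 : (c * (p ^ m : ℕ)) • P₂ = p ^ k • (W.reductionPointCount p • Q) := by
      rw [← hkey, ← hQ, nsmul_left_comm Q (W.reductionPointCount p) (p ^ k)]
    have hnQ : W.reductionPointCount p • Q ∈ (W.baseChange ℚ_[p]).formalFiltration 1 := by
      rw [(W.baseChange ℚ_[p]).formalFiltration_one_eq_zero]
      exact (W.baseChange ℚ_[p]).mem_formalFiltration_zero_iff.mpr (hker Q)
    have hdvd : (p ^ k : ℤ) ∣ c * (p ^ m : ℕ) :=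
      pow_dvd_of_zsmul_eq_pow_smul_of_level_one (W.baseChange ℚ_[p]) hp2 hP₂ hP₂' hnQ h1
    rw [Nat.cast_pow, ← hpk] at hdvd
    exact (mul_dvd_mul_iff_right
      (pow_ne_zero m (Nat.cast_ne_zero.mpr (Fact.out : p.Prime).ne_zero))).mp hdvd
  · rintro ⟨c', rfl⟩
    rw [exists_pow_smul_eq_iff_nsmul_mem_formalFiltration (W.baseChange ℚ_[p]) hp2 hna hker _ k, hkey]
    have hcoef : (p : ℤ) ^ (k - m) * c' * ((p ^ m : ℕ) : ℤ) = ((p ^ k : ℕ) : ℤ) * c' := by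
      rw [Nat.cast_pow, Nat.cast_pow, ← hpk]
      ring
    rw [hcoef, mul_zsmul, natCast_zsmul]
    have h := pow_smul_mem_formalFiltration_add (W.baseChange ℚ_[p]) (AddSubgroup.zsmul_mem _ hP₂ c') k
    rwa [add_comm] at h

/-- **C-16's `m₃(P) = 0` clause makes `P` a generator of `E(ℚ₃)/3^k·E(ℚ₃) ≅ ℤ/3^k` for every `k`**: at a
good non-anomalous `3` (`a₃ ∉ {1, −2}`), `¬ PointLocallyThreeDivisibleAt W 3 P` for a rational point `P`
gives, in `E(ℚ₃)`: every `R` is `c·P + 3^k·Q`, and `c·P ∈ 3^k·E(ℚ₃) ⟹ 3^k ∣ c` — the local input of the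
depth-law derivation at `p = 3` (R1-DEPTH-LAW §2 (i), (iii)) as a theorem. [cite: SilvermanAEC2009, IV.6.4 (b) and VII.2.1] -/
theorem generates_mod_pow_three_of_not_pointLocallyThreeDivisibleAt
    (hgood : W.HasGoodReductionAtPrime 3) (ha1 : W.frobeniusTrace 3 ≠ 1) (ha2 : W.frobeniusTrace 3 ≠ -2)
    {P : W.toAffine.Point} (hP : ¬ O5.PointLocallyThreeDivisibleAt W 3 P) (k : ℕ) :
    (∀ R : (W.baseChange ℚ_[3]).toAffine.Point, ∃ (c : ℤ) (Q : (W.baseChange ℚ_[3]).toAffine.Point),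
        R = c • Affine.Point.map (W' := W.toAffine) (Algebra.ofId ℚ ℚ_[3]) P + 3 ^ k • Q) ∧
      ∀ (c : ℤ) (Q : (W.baseChange ℚ_[3]).toAffine.Point),
        c • Affine.Point.map (W' := W.toAffine) (Algebra.ofId ℚ ℚ_[3]) P = 3 ^ k • Q → (3 ^ k : ℤ) ∣ c := by
  have hΔ := not_dvd_minimalDiscriminantInt_of_hasGoodReductionAtPrime' W 3 hgood
  -- `3 ∤ #Ẽ(𝔽₃)`: `#Ẽ(𝔽₃) ∈ [1, 7]` and `a₃ = 4 − #Ẽ(𝔽₃) ∉ {1, −2}`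
  have hna : ¬ 3 ∣ W.reductionPointCount 3 := by
    have hN : W.reductionPointCount 3 ≤ 2 * 3 + 1 := by
      have h := natCard_point_le_two_mul_card_add_one
        ((integralModelInt W).map (Int.castRingHom (ZMod 3)))
      rwa [ZMod.card] at h
    have hN1 : 1 ≤ W.reductionPointCount 3 := by
      rw [reductionPointCount]
      exact Nat.card_pos
    have ha : W.frobeniusTrace 3 = (3 : ℕ) + 1 - (W.reductionPointCount 3 : ℤ) := rfl
    push_cast at ha
    omega
  have hP' : ¬ ∃ Q : (W.baseChange ℚ_[3]).toAffine.Point,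
      3 • Q = Affine.Point.map (W' := W.toAffine) (Algebra.ofId ℚ ℚ_[3]) P :=
    fun ⟨Q, hQ⟩ => hP ⟨Q, hQ.symm⟩
  exact generates_mod_pow_of_not_exists_p_smul_eq W 3 (by norm_num) hΔ hna hP' k

end Global

end Summit.BirchSwinnertonDyer.Rank1Residual.Ordinary

end
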